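import Mathlib.NumberTheory.LSeries.RiemannZeta
import Literature.NumberTheory.LFunctions.ZetaZeros
import Literature.NumberTheory.LFunctions.WeilExplicit
import Literature.NumberTheory.LFunctions.RHConditionalFacts
import HarnessLib

-- provenance: harness21/H21/H21/Statements/RH/WeilCriterion.lean @ cfecf1d (interim HEAD d8f2665); M5 mechanical rewrite
/-!
# The Guinand–Weil explicit formula and Weil's positivity criterion (family `rh`)

Target statements **rh.S30** (Guinand–Weil explicit formula) and **rh.S29** (Weil's criterion
`RH ↔ W(g ⋆ g̃) ≥ 0`, Yoshida's truncated version, and the wall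
`rh-w-uniform-weil-positivity`), outline `H21/Outlines/AntSieve.md` §3, item `RHWeilCriterion`.

All the analytic objects live in the prelude `Literature.Prelude.AntSieve.WeilExplicit`, in the additive
normalisation symmetric at `1/2` (outline D-ANT-8): test functions `g : ℝ → ℂ` with
`IsWeilTest g` (smooth, compact support), transform `weilMellin g s = ĝ(s) = ∫ g(t) e^{(s-1/2)t} dt`,
involution `weilReflect g = g̃`, `g̃(t) = conj g(-t)`, convolution `weilConv` (Mathlib's
`MeasureTheory.convolution`), the Weil functional `weilFunctional g = W(g)`, the symmetric zero
sum `HasWeilZeroSide`, the quadratic functional `weilQuadratic g = W(g ⋆ g̃)` and the positivity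
predicates `WeilPositivity`, `WeilPositivityOn a`, and the ground energy `weilGroundEnergy a = ε(a)`.
This file only states the theorems.

## Contents

* `guinand_weil_explicit_formula` (**rh.S30**): `∑_ρ m(ρ) ĝ(ρ) = W(g)`.
* `weil_criterion` (**rh.S29**): `RiemannHypothesis ↔ WeilPositivity` — lives in `RHConditionalFacts.lean` (imported).
* `yoshida_criterion (h : weil_criterion)`: `RiemannHypothesis ↔ ∀ a > 0, WeilPositivityOn a`.
* `UniformWeilPositivity` (the wall `rh-w-uniform-weil-positivity`, `sInf`-free `∀`-form) and
  `uniformWeilPositivity_iff : UniformWeilPositivity ↔ RiemannHypothesis`.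
  `UniformWeilPositivity` is a registered OPEN statement (`OPEN CONJECTURE — … [status: open]`,
  `@[conjecture]`), not a named fact awaiting discharge: it is equivalent to the Riemann
  hypothesis unconditionally in the tree (`uniformWeilPositivity_iff_riemannHypothesis`,
  `UniformWeilPositivityRH.lean`, which imports this file), exactly like the sibling open statement
  `WeilPositivity` of `WeilExplicit.lean`. Its earlier locator (Bombieri 2000 §4) is where the
  ground energy `ε(a)` is DEFINED (Problems 1–2) and shown to be attained (Thms. 3–5), with no
  sign information; no source proves `ε(a) ≥ 0` for all `a > 0` (defact verdict 2026-08-16).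
* `weilPositivityOn_of_riemannHypothesis`: `RH → ε(a) ≥ 0` (in `∀`-form), given `weil_criterion`.

`weil_criterion` (`RHConditionalFacts.lean`) and `explicit_formula` (`WeilExplicit.lean`) are the
only NAMED FACTS used (both since discharged downstream: `weil_criterion_holds`,
`WeilCriterionProofs.lean`; `explicit_formula_holds`, `WeilExplicitFormulaProofs.lean`); everything
in this file is proved from them. This file declares NO named fact.

## Mathlib

`RiemannHypothesis` is Mathlib's (`Mathlib/NumberTheory/LSeries/RiemannZeta.lean`). Mathlib has no
explicit formula and no Weil functional (searched `Guinand`, `Weil`, `explicit formula` in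
`NumberTheory/`); those come from the H21 prelude.

## References

* A. Weil, *Sur les "formules explicites" de la théorie des nombres premiers*, Comm. Sém. Math.
  Univ. Lund (1952).
* H. Yoshida, *On Hermitian forms attached to zeta functions*, in: Zeta functions in geometry,
  Adv. Stud. Pure Math. 21 (1992).
* E. Bombieri, *Remarks on Weil's quadratic functional in the theory of prime numbers I*,
  Rend. Mat. Acc. Lincei (9) 11 (2000), 183–233 (bib `Bombieri2000Weil`; Zbl 1008.11034):
  §3 Theorems 1–2 (Weil's criterion); §4 Problems 1–2, Thms. 3–5 (the ground energy `ε(a)`,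
  attained, no sign information); §12 Thm. 12 (positivity for small support).
* H. Iwaniec, E. Kowalski, *Analytic Number Theory* (2004), Theorem 5.12.
* Summit `rh-w-uniform-weil-positivity` (gap inventory, family `rh`).
-/

noncomputable section

open Complex Filter Set

namespace Literature.NumberTheory.LFunctions

/-! ## rh.S30: the Guinand–Weil explicit formula -/

/-- **rh.S30** (Guinand–Weil explicit formula; Weil 1952; Bombieri 2000 Thm 2 normalisation
transported by `x = e^t`; Iwaniec–Kowalski Thm 5.12). For every smooth compactly supported
`g : ℝ → ℂ`, with `ĝ(s) = ∫ g(t) e^{(s - 1/2)t} dt`,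
`lim_{T → ∞} ∑_{ζ(ρ) = 0, 0 ≤ Re ρ ≤ 1, 0 < |Im ρ| ≤ T} m(ρ) ĝ(ρ)
  = ĝ(0) + ĝ(1) - ∑ₙ Λ(n) n^{-1/2} (g(log n) + g(-log n))
    + (1/2π) ∫ ĝ(1/2 + it) Re ψ(1/4 + it/2) dt - g(0) log π`,
i.e. polar term `weilPolarTerm g`, minus prime term `weilPrimeTerm g`, plus archimedean (digamma)
term `weilArchTerm g`; the zeros are summed symmetrically in `|Im ρ| ≤ T` with multiplicity
`m(ρ) = riemannZetaZeroOrder ρ`. This is the prelude named fact `explicit_formula` (a `Prop`,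
D-0014) under its inventory id: the theorem takes it as hypothesis `h`. [cite: Weil1952] -/
theorem guinand_weil_explicit_formula (h : explicit_formula) (g : ℝ → ℂ) (hg : IsWeilTest g) :
    HasWeilZeroSide g (weilFunctional g) :=
  h hg

/-! ## rh.S29: Weil's criterion and the uniform-positivity wall -/

/-- OPEN CONJECTURE — uniform Weil positivity for `ζ`, the **rh.S29** wall
`rh-w-uniform-weil-positivity` [status: open]: `ε(a) ≥ 0` for all `a > 0`, stated `sInf`-free as
`∀ a > 0, WeilPositivityOn a`, i.e. `Re W(g ⋆ g̃) ≥ 0` for every `a > 0` and every smooth `g`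
supported in `[-a, a]`. Since `Q(c • g) = |c|² Q(g)`, the `L²`-normalisation `‖g‖₂ = 1` in
`ε(a) = inf {Q(g) : supp g ⊆ [-a, a], ‖g‖₂ = 1}` does not affect the sign, so this is exactly
`ε(a) ≥ 0 ∀ a > 0`; the `sInf` number `weilGroundEnergy a = ε(a)` is related by the prelude lemma
`weilGroundEnergy_nonneg_iff`.

STATUS (defact verdict 2026-08-16). This is NOT a published theorem and not literature debt: it is
EQUIVALENT TO THE RIEMANN HYPOTHESIS, unconditionally in the tree —
`uniformWeilPositivity_iff_riemannHypothesis : UniformWeilPositivity ↔ RiemannHypothesis`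
(`UniformWeilPositivityRH.lean`: `uniformWeilPositivity_iff` below fed with the discharged Weil
criterion `weil_criterion_holds`; axioms `propext`, `Classical.choice`, `Quot.sound`), so a term
`UniformWeilPositivity_holds` would be a proof of Mathlib's `RiemannHypothesis`. It is therefore
a registered OPEN statement (CONVENTIONS §4), like the sibling `WeilPositivity`
(`WeilExplicit.lean`), to which it is elementarily equivalent
(`uniformWeilPositivity_iff_weilPositivity`); users take `(h : UniformWeilPositivity)`.
POSED in this fixed-support form by H. Yoshida (1992), who studied Weil's hermitian form on
functions supported in `[-t, t]`, reduced its positivity for FIXED `t` to a finite calculation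
and verified it for `t = (log 2)/2` (reported in Bombieri 2000, §1 p. 184), and by E. Bombieri
(2000): Abstract ("positive semidefinite if and only if the Riemann Hypothesis is true"), §3
Thm. 2 (`RH ⇔ T[f * f̄*] ≥ 0` on `C₀^∞((0, ∞))`) and §4 Problems 1–2 (minimise `T[f * f̄*]` over
functions supported in `[M⁻¹, M]`); §4 Thms. 3–5 prove that the infimum is attained / varies
continuously, with NO sign information, and §1: a direct study of Weil's functional "appears to
be as intractable as the Riemann Hypothesis itself". The earlier tag of this declaration
(Bombieri 2000 §4) pointed at where `ε(a)` is DEFINED, not at a proof. What the sources DO prove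
towards the wall is in the tree and proved: `WeilPositivityOn a` for every `a ≤ (log 2)/2`
(`weilPositivityOn_of_le_log_two_half`, `UniformWeilPositivityRH.lean`; Yoshida 1992 Thm. 1,
Bombieri 2000 §12 Thm. 12). Name kept without a `…Conjecture` suffix because it has users
(`uniformWeilPositivity_iff_weilPositivity`, `uniformWeilPositivity_iff`,
`UniformWeilPositivityRH.lean`, `WeilSmallSupportPositivity.lean`, route files under
`Summits/RiemannHypothesis/`).
[cite: Bombieri2000Weil, §1 p. 184 (Yoshida's fixed-support formulation); §3 Thm. 2; §4 Problems 1–2] -/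
@[conjecture] def UniformWeilPositivity : Prop :=
  ∀ a : ℝ, 0 < a → WeilPositivityOn a

/-- `UniformWeilPositivity` is equivalent to plain `WeilPositivity` (every compactly supported
`g` has `tsupport g ⊆ [-a, a]` for some `a > 0`). Elementary; recorded to make the relation
between the two shapes of rh.S29 explicit. [folklore] -/
theorem uniformWeilPositivity_iff_weilPositivity : UniformWeilPositivity ↔ WeilPositivity := by
  refine ⟨fun h g hg ↦ ?_, fun h a _ g hg _ ↦ h g hg⟩
  obtain ⟨r, hr⟩ := (hg.2.isCompact.isBounded).subset_closedBall 0
  refine h (max r 1) (lt_max_of_lt_right one_pos) g hg fun t ht ↦ ?_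
  have := hr ht
  rw [Metric.mem_closedBall, Real.dist_eq, sub_zero, abs_le] at this
  exact ⟨by linarith [le_max_left r 1], by linarith [le_max_left r 1]⟩

/-! ## rh.S29: Yoshida's criterion and corollaries of `weil_criterion` -/

/-- **Yoshida's (truncated) criterion**, as a consequence of Weil's criterion
(`Literature.NumberTheory.LFunctions.weil_criterion`, `RHConditionalFacts.lean`) and the elementary
`uniformWeilPositivity_iff_weilPositivity`: the Riemann hypothesis holds iff Weil positivity holds
on every truncated cone `K_a`, `a > 0` (`WeilPositivityOn a`), equivalently `ε(a) ≥ 0` for all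
`a > 0`. (Yoshida's finer statement — positivity on `K_a` controls the zeros up to a height related
to `a` — is not needed by the route.) [Yoshida 1992; Bombieri 2000, §4] [cite: Yoshida1992, Thm. 1] -/
theorem yoshida_criterion (h : weil_criterion) :
    RiemannHypothesis ↔ ∀ a : ℝ, 0 < a → WeilPositivityOn a :=
  h.trans uniformWeilPositivity_iff_weilPositivity.symm

/-- **The wall in `RH`-form**: `UniformWeilPositivity ↔ RiemannHypothesis`, given Weil's
criterion. [Bombieri 2000, Thm. 1 and §4] [folklore] -/
theorem uniformWeilPositivity_iff (h : weil_criterion) : UniformWeilPositivity ↔ RiemannHypothesis :=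
  uniformWeilPositivity_iff_weilPositivity.trans h.symm

/-- `RH → ε(a) ≥ 0` in the `∀`-form: under Weil's criterion, the Riemann hypothesis gives Weil
positivity on every `K_a`. [Bombieri 2000, Thm. 1] [folklore] -/
theorem weilPositivityOn_of_riemannHypothesis (h : weil_criterion) (hRH : RiemannHypothesis)
    (a : ℝ) (ha : 0 < a) : WeilPositivityOn a :=
  (uniformWeilPositivity_iff_weilPositivity.2 (h.1 hRH)) a ha

end Literature.NumberTheory.LFunctions

end
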